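import Summits.CriticalPhenomena.PercolationContinuityZ3.Theorems.PercNearOneGluingNoHeavyLowerTailAttachedChampionCardSubTwo
import Literature.Probability.Percolation.TwoSetExchange
import Literature.Probability.Percolation.KozmaNitzanPreFKG
import HarnessLib

/-!
# `NoHeavyLowerTail` (stmt-CriticalPhenomena-4575) — two-level packing at level `|A| − 2`: tools

Support file (lemma factory #8 `prim-lf-8`, gen 5; `--supports stmt-CriticalPhenomena-4575`).  No definitions, no named
facts, no sorries.  `μ = prodBernoulli w` on `Fin n`, relays `A` (`k = |A|`), observer `o`, level `j = k − 2`;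
`D_d = {d ↮ A∖d}`, `Q_d = {A∖d pairwise joined}`, `H_d = D_d ∩ Q_d` (the relay partition is `(A∖d | d)`),
`h(d) = μ(H_d)`, `Sep = {A pairwise separated}`, `U = ⋃_{b ∈ A∖c} {o ↔ b}`.

Tools for `…TwoLevelPackingCardSubTwo.lean` (QP at level `|A| − 2` for every `|A|`):

* `packingChain_of_pairSep_pos` — the PACKING form of the lead's level-`(k−2)` chain
  (`AttachedChampionCardSubTwo.chain_of_pairSep_pos`): if `h(d) ≤ τ` for all `d ≠ c` and `μ(Sep) > 0` then
  `(Σ_{d ≠ c} μ({o↔d} ∩ H_d)) · h(c) ≤ τ · μ(D_c ∩ (U ∩ Q_c))`  (KN Lemma 1(ii)+(i) per `d`, disjointness in `Sep`,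
  set-BHK back at `c`);
* `blockEq_exchange` / `cut_exchange` — two instances of the two-SET exchange inequality (BHK 2006 Thm 1.5 with sets,
  `Literature.…setTwoClusterExchange`) at `S = {c}`, `T = A ∖ B`:
  `μ({π(c) = B} ∩ {o ↔ T})·μ(c ↮ T) ≤ μ({π(c) = B})·μ({c ↮ T} ∩ {o ↔ T})` and
  `μ({c ↮ T} ∩ {o ↔ T})·μ(D_c) ≤ μ(c ↮ T)·μ(D_c ∩ {o ↔ T})`;
* `real_eq_sum_blocks` — partition of an event by the relay block of `c`.
-/

noncomputable section

namespace Summit.CriticalPhenomena.PercolationContinuityZ3.Theorems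

open MeasureTheory Set Filter Literature.Probability.LatticeModels Literature.Probability.Percolation
open scoped Classical BigOperators Topology

namespace TwoLevelPackingCardSubTwo

variable {n : ℕ}

/-- **Packing form of the level-`|A|−2` chain (non-null separation event).**  With `H_d = D_d ∩ Q_d`,
`U = ⋃_{b ∈ A∖c} {o ↔ b}`: if `0 ≤ τ`, `μ(H_d) ≤ τ` for `d ∈ A ∖ c` and `μ(Sep) > 0`, then
`(Σ_{d ∈ A∖c} μ({o↔d} ∩ D_d ∩ Q_d)) · μ(D_c ∩ Q_c) ≤ τ · μ(D_c ∩ (U ∩ Q_c))`.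
[cite: KozmaNitzan2024, Lemmas 1–2 (pp. 5–6); VandenbergHaggstromKahn2005, Thms. 1.3, 1.5] -/
theorem packingChain_of_pairSep_pos (w : Sym2 (Fin n) → unitInterval) (A : Finset (Fin n)) (o c : Fin n) (τ : ℝ)
    (hτ : 0 ≤ τ) (hc : c ∈ A)
    (hdom : ∀ d ∈ A.erase c,
      (prodBernoulli w).real ({ω : BondConfig (Fin n) | ∀ t ∈ A.erase d, ω ∉ openConn d t} ∩
          {ω | ∀ t ∈ (↑(A.erase d) : Set (Fin n)), ∀ t' ∈ (↑(A.erase d) : Set (Fin n)), ω ∈ openConn t t'}) ≤ τ)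
    (hM : 0 < (prodBernoulli w).real
      {ω : Set (Sym2 (Fin n)) | ∀ x ∈ A, ∀ y ∈ A, x ≠ y → ω ∉ openConn x y}) :
    (∑ d ∈ A.erase c, (prodBernoulli w).real
        (openConn o d ∩ {ω : BondConfig (Fin n) | ∀ t ∈ A.erase d, ω ∉ openConn d t} ∩
          {ω | ∀ t ∈ (↑(A.erase d) : Set (Fin n)), ∀ t' ∈ (↑(A.erase d) : Set (Fin n)), ω ∈ openConn t t'})) *
      (prodBernoulli w).real ({ω : BondConfig (Fin n) | ∀ t ∈ A.erase c, ω ∉ openConn c t} ∩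
          {ω | ∀ t ∈ (↑(A.erase c) : Set (Fin n)), ∀ t' ∈ (↑(A.erase c) : Set (Fin n)), ω ∈ openConn t t'}) ≤
      τ * (prodBernoulli w).real ({ω : BondConfig (Fin n) | ∀ t ∈ A.erase c, ω ∉ openConn c t} ∩
        ((⋃ b ∈ A.erase c, openConn o b) ∩
          {ω | ∀ t ∈ (↑(A.erase c) : Set (Fin n)), ∀ t' ∈ (↑(A.erase c) : Set (Fin n)), ω ∈ openConn t t'})) := by
  set μ := prodBernoulli w with hμ
  set Sep : Set (BondConfig (Fin n)) := {ω | ∀ x ∈ A, ∀ y ∈ A, x ≠ y → ω ∉ openConn x y} with hSep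
  set D : Fin n → Set (BondConfig (Fin n)) := fun d => {ω | ∀ t ∈ A.erase d, ω ∉ openConn d t} with hD
  set Qc : Fin n → Set (BondConfig (Fin n)) :=
    fun d => {ω | ∀ t ∈ (↑(A.erase d) : Set (Fin n)), ∀ t' ∈ (↑(A.erase d) : Set (Fin n)), ω ∈ openConn t t'} with hQc
  set U : Set (BondConfig (Fin n)) := ⋃ b ∈ A.erase c, openConn o b with hU
  have hmeas : ∀ s : Set (BondConfig (Fin n)), MeasurableSet s := fun _ => MeasurableSet.of_discrete
  have hnn : ∀ s : Set (BondConfig (Fin n)), 0 ≤ μ.real s := fun _ => measureReal_nonneg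
  -- (1) per relay `d ≠ c`: `g_d · μ(Sep) ≤ h(d) · μ({o↔d} ∩ Sep)` (KN Lemma 1(ii) then 1(i))
  have h1 : ∀ d ∈ A.erase c,
      μ.real (openConn o d ∩ D d ∩ Qc d) * μ.real Sep ≤ μ.real (D d ∩ Qc d) * μ.real (openConn o d ∩ Sep) := by
    intro d hd
    have hdA : d ∈ A := Finset.mem_of_mem_erase hd
    have hneg : μ.real (D d) * μ.real (openConn o d ∩ D d ∩ Qc d) ≤
        μ.real (openConn o d ∩ D d) * μ.real (D d ∩ Qc d) :=
      GuardedLonelyRelay.negCorr w A o d (Qc d) _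
        (GuardedLonelyRelay.connAllFn_monotone (↑(A.erase d) : Set (Fin n)))
        (GuardedLonelyRelay.connAllFn_biUnion_openEdgeCluster _)
    have hts : μ.real (openConn o d ∩ D d) * μ.real Sep ≤ μ.real (D d) * μ.real (openConn o d ∩ Sep) :=
      GuardedLonelyRelay.termSep w A o hdA
    by_cases hDz : μ.real (D d) = 0
    · have hT : μ.real (openConn o d ∩ D d ∩ Qc d) = 0 :=
        le_antisymm (hDz ▸ measureReal_mono (fun ω hω => hω.1.2) (measure_ne_top μ _)) (hnn _)
      rw [hT, zero_mul]
      exact mul_nonneg (hnn _) (hnn _)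
    · have hDpos : 0 < μ.real (D d) := lt_of_le_of_ne (hnn _) (Ne.symm hDz)
      have key : μ.real (D d) * (μ.real (openConn o d ∩ D d ∩ Qc d) * μ.real Sep) ≤
          μ.real (D d) * (μ.real (D d ∩ Qc d) * μ.real (openConn o d ∩ Sep)) := by
        calc μ.real (D d) * (μ.real (openConn o d ∩ D d ∩ Qc d) * μ.real Sep)
            = (μ.real (D d) * μ.real (openConn o d ∩ D d ∩ Qc d)) * μ.real Sep := by ring
          _ ≤ (μ.real (openConn o d ∩ D d) * μ.real (D d ∩ Qc d)) * μ.real Sep :=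
              mul_le_mul_of_nonneg_right hneg (hnn _)
          _ = μ.real (D d ∩ Qc d) * (μ.real (openConn o d ∩ D d) * μ.real Sep) := by ring
          _ ≤ μ.real (D d ∩ Qc d) * (μ.real (D d) * μ.real (openConn o d ∩ Sep)) :=
              mul_le_mul_of_nonneg_left hts (hnn _)
          _ = μ.real (D d) * (μ.real (D d ∩ Qc d) * μ.real (openConn o d ∩ Sep)) := by ring
      exact le_of_mul_le_mul_left key hDpos
  -- (2) sum over `d ≠ c` with `h(d) ≤ τ`; disjointness of `{o↔d} ∩ Sep`
  have hU_sum : ∑ d ∈ A.erase c, μ.real (openConn o d ∩ Sep) = μ.real (U ∩ Sep) := by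
    rw [hU, Set.iUnion₂_inter]
    exact (measureReal_biUnion_finset
      (singleFinger_pairwiseDisjoint_conn_inter_pairSep A (A.erase c) o (Finset.erase_subset c A))
      (fun b _ => hmeas _)).symm
  have h2 : (∑ d ∈ A.erase c, μ.real (openConn o d ∩ D d ∩ Qc d)) * μ.real Sep ≤ τ * μ.real (U ∩ Sep) := by
    rw [Finset.sum_mul]
    calc ∑ d ∈ A.erase c, μ.real (openConn o d ∩ D d ∩ Qc d) * μ.real Sep
        ≤ ∑ d ∈ A.erase c, τ * μ.real (openConn o d ∩ Sep) :=
          Finset.sum_le_sum fun d hd => (h1 d hd).trans (mul_le_mul_of_nonneg_right (hdom d hd) (hnn _))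
      _ = τ * μ.real (U ∩ Sep) := by rw [← Finset.mul_sum, hU_sum]
  -- (3) the two set-BHK steps at `c`: `h(c) μ(U ∩ Sep) ≤ μ(D_c ∩ (U ∩ Q_c)) μ(Sep)`
  have hSepEq : D c ∩ {ω : BondConfig (Fin n) | ∀ t ∈ A.erase c, ∀ t' ∈ A.erase c, t ≠ t' → ω ∉ openConn t t'}
      = Sep := by
    rw [hD, hSep]; exact singleFinger_sep_inter_pairSep_eq A hc
  have h4 : μ.real (D c) * μ.real (U ∩ Sep) ≤ μ.real (D c ∩ U) * μ.real Sep := by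
    have key := AttachedChampionLevelOne.sep_touch_negCorr w (A.erase c) c o
    have hUS : D c ∩ (U ∩ {ω : BondConfig (Fin n) | ∀ t ∈ A.erase c, ∀ t' ∈ A.erase c, t ≠ t' →
        ω ∉ openConn t t'}) = U ∩ Sep := by
      rw [← hSepEq, ← Set.inter_assoc, Set.inter_comm (D c) U, Set.inter_assoc]
    rw [hUS, hSepEq] at key
    exact key
  have h5 : μ.real (D c ∩ U) * μ.real (D c ∩ Qc c) ≤ μ.real (D c) * μ.real (D c ∩ (U ∩ Qc c)) := by
    have hQ : Qc c = {ω : BondConfig (Fin n) | ∀ t ∈ A.erase c, ∀ t' ∈ A.erase c, ω ∈ openConn t t'} := rfl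
    rw [hQ]
    exact AttachedChampionCardSubTwo.touch_connAll_posCorr w (A.erase c) c o
  have h3 : μ.real (D c ∩ Qc c) * μ.real (U ∩ Sep) ≤ μ.real (D c ∩ (U ∩ Qc c)) * μ.real Sep := by
    by_cases hDz : μ.real (D c) = 0
    · have hh : μ.real (D c ∩ Qc c) = 0 :=
        le_antisymm (hDz ▸ measureReal_mono Set.inter_subset_left (measure_ne_top μ _)) (hnn _)
      rw [hh, zero_mul]
      exact mul_nonneg (hnn _) (hnn _)
    · have hDpos : 0 < μ.real (D c) := lt_of_le_of_ne (hnn _) (Ne.symm hDz)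
      have key : μ.real (D c) * (μ.real (D c ∩ Qc c) * μ.real (U ∩ Sep)) ≤
          μ.real (D c) * (μ.real (D c ∩ (U ∩ Qc c)) * μ.real Sep) := by
        calc μ.real (D c) * (μ.real (D c ∩ Qc c) * μ.real (U ∩ Sep))
            = μ.real (D c ∩ Qc c) * (μ.real (D c) * μ.real (U ∩ Sep)) := by ring
          _ ≤ μ.real (D c ∩ Qc c) * (μ.real (D c ∩ U) * μ.real Sep) :=
              mul_le_mul_of_nonneg_left h4 (hnn _)
          _ = (μ.real (D c ∩ U) * μ.real (D c ∩ Qc c)) * μ.real Sep := by ring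
          _ ≤ (μ.real (D c) * μ.real (D c ∩ (U ∩ Qc c))) * μ.real Sep :=
              mul_le_mul_of_nonneg_right h5 (hnn _)
          _ = μ.real (D c) * (μ.real (D c ∩ (U ∩ Qc c)) * μ.real Sep) := by ring
      exact le_of_mul_le_mul_left key hDpos
  -- (4) combine and divide by `μ(Sep) > 0`
  have hfin : (∑ d ∈ A.erase c, μ.real (openConn o d ∩ D d ∩ Qc d)) * μ.real (D c ∩ Qc c) * μ.real Sep ≤
      τ * μ.real (D c ∩ (U ∩ Qc c)) * μ.real Sep := by
    have hS0 : 0 ≤ ∑ d ∈ A.erase c, μ.real (openConn o d ∩ D d ∩ Qc d) := Finset.sum_nonneg fun _ _ => hnn _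
    calc (∑ d ∈ A.erase c, μ.real (openConn o d ∩ D d ∩ Qc d)) * μ.real (D c ∩ Qc c) * μ.real Sep
        = ((∑ d ∈ A.erase c, μ.real (openConn o d ∩ D d ∩ Qc d)) * μ.real Sep) * μ.real (D c ∩ Qc c) := by ring
      _ ≤ (τ * μ.real (U ∩ Sep)) * μ.real (D c ∩ Qc c) := mul_le_mul_of_nonneg_right h2 (hnn _)
      _ = τ * (μ.real (D c ∩ Qc c) * μ.real (U ∩ Sep)) := by ring
      _ ≤ τ * (μ.real (D c ∩ (U ∩ Qc c)) * μ.real Sep) := mul_le_mul_of_nonneg_left h3 hτ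
      _ = τ * μ.real (D c ∩ (U ∩ Qc c)) * μ.real Sep := by ring
  exact le_of_mul_le_mul_right hfin hM

/-- The two-set separation event at `S = {c}`, `T = ↑T` is `{c ↮ T}`. [folklore] -/
theorem sep_singleton_eq (c : Fin n) (T : Finset (Fin n)) :
    {ω : BondConfig (Fin n) | ∀ s ∈ ({c} : Set (Fin n)), ∀ t ∈ (↑T : Set (Fin n)), ¬ (openGraph ω).Reachable s t} =
      {ω | ∀ t ∈ T, ω ∉ openConn c t} := by
  ext ω
  simp only [mem_setOf_eq, mem_singleton_iff, forall_eq, Finset.mem_coe]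
  rfl

/-- **Block/attachment exchange** (two-set exchange at `S = {c}`, `T`): for a finite set `B` of vertices and a finite set
`T` of vertices, with `O_T = ⋃_{t ∈ T} {o ↔ t}`:
`μ({c ↮ T} ∩ {c ↔ B} ∩ O_T) · μ(c ↮ T) ≤ μ({c ↮ T} ∩ {c ↔ B}) · μ({c ↮ T} ∩ O_T)` — given `c ↮ T`, the increasing
cluster event `{c ↔ every b ∈ B}` and the attachment of `o` to `T` (off `C(c)`) are negatively correlated.
[cite: VandenbergHaggstromKahn2005, Thm. 2.1 (p. 9) at q = 1 / Thm. 1.5 with sets — corollary] -/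
theorem blockEq_exchange (w : Sym2 (Fin n) → unitInterval) (B T : Finset (Fin n)) (o c : Fin n) :
    (prodBernoulli w).real ({ω : BondConfig (Fin n) | ∀ t ∈ T, ω ∉ openConn c t} ∩
        ({ω | ∀ b ∈ B, ω ∈ openConn c b} ∩ ⋃ t ∈ T, (openConn o t : Set (BondConfig (Fin n))))) *
      (prodBernoulli w).real {ω : BondConfig (Fin n) | ∀ t ∈ T, ω ∉ openConn c t} ≤
    (prodBernoulli w).real ({ω : BondConfig (Fin n) | ∀ t ∈ T, ω ∉ openConn c t} ∩
        {ω | ∀ b ∈ B, ω ∈ openConn c b}) *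
      (prodBernoulli w).real ({ω : BondConfig (Fin n) | ∀ t ∈ T, ω ∉ openConn c t} ∩
        ⋃ t ∈ T, (openConn o t : Set (BondConfig (Fin n)))) := by
  set Sx : Set (Fin n) := {c} with hSx
  set Tx : Set (Fin n) := ↑T with hTx
  have hcS : c ∈ Sx := by rw [hSx]; exact mem_singleton c
  have key := setTwoClusterExchange w Sx Tx
    (A₁ := {ω : BondConfig (Fin n) | ∀ b ∈ B, ω ∈ openConn c b})  (A₂ := univ)
    (B₁ := ⋃ t ∈ T, (openConn t o : Set (BondConfig (Fin n)))) (B₂ := univ)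
    (fun ω ω' hs ht h b hb => TwoSetExchange.typePlus_openConn_of_mem Sx Tx hcS b hs ht (h b hb))
    (fun _ _ _ _ _ => mem_univ _)
    (fun ω ω' hs ht h => by
      obtain ⟨t, htT, hω⟩ := mem_iUnion₂.1 h
      exact mem_iUnion₂.2 ⟨t, htT, TwoSetExchange.typeMinus_openConn_of_mem Sx Tx (Finset.mem_coe.2 htT) o hs ht hω⟩)
    (fun _ _ _ _ _ => mem_univ _)
  have hOT : (⋃ t ∈ T, (openConn t o : Set (BondConfig (Fin n)))) = ⋃ t ∈ T, (openConn o t : Set (BondConfig (Fin n))) := by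
    refine iUnion₂_congr fun t _ => ?_
    exact KNPreFKG.openConn_symm t o
  rw [sep_singleton_eq c T, hOT] at key
  simpa only [inter_univ, univ_inter] using key

/-- **Cut exchange** (two-set exchange at `S = {c}`, `T`, two events of type `(−)`): for finite `B'`, `T` and
`O_T = ⋃_{t ∈ T} {o ↔ t}`:
`μ({c ↮ T} ∩ O_T) · μ({c ↮ T} ∩ {c ↮ B'}) ≤ μ(c ↮ T) · μ({c ↮ T} ∩ ({c ↮ B'} ∩ O_T))` — given `c ↮ T`, cutting `c`
from further vertices and attaching `o` to `T` are positively correlated.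
[cite: VandenbergHaggstromKahn2005, Thm. 2.1 (p. 9) at q = 1 / Thm. 1.5 with sets — corollary] -/
theorem cut_exchange (w : Sym2 (Fin n) → unitInterval) (B' T : Finset (Fin n)) (o c : Fin n) :
    (prodBernoulli w).real ({ω : BondConfig (Fin n) | ∀ t ∈ T, ω ∉ openConn c t} ∩
        ⋃ t ∈ T, (openConn o t : Set (BondConfig (Fin n)))) *
      (prodBernoulli w).real ({ω : BondConfig (Fin n) | ∀ t ∈ T, ω ∉ openConn c t} ∩
        {ω | ∀ b ∈ B', ω ∉ openConn c b}) ≤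
    (prodBernoulli w).real {ω : BondConfig (Fin n) | ∀ t ∈ T, ω ∉ openConn c t} *
      (prodBernoulli w).real ({ω : BondConfig (Fin n) | ∀ t ∈ T, ω ∉ openConn c t} ∩
        ({ω | ∀ b ∈ B', ω ∉ openConn c b} ∩ ⋃ t ∈ T, (openConn o t : Set (BondConfig (Fin n))))) := by
  set Sx : Set (Fin n) := {c} with hSx
  set Tx : Set (Fin n) := ↑T with hTx
  have hcS : c ∈ Sx := by rw [hSx]; exact mem_singleton c
  have key := setTwoClusterExchange w Sx Tx (A₁ := univ) (A₂ := univ)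
    (B₁ := ⋃ t ∈ T, (openConn t o : Set (BondConfig (Fin n))))
    (B₂ := {ω : BondConfig (Fin n) | ∀ b ∈ B', ω ∉ openConn c b})
    (fun _ _ _ _ _ => mem_univ _) (fun _ _ _ _ _ => mem_univ _)
    (fun ω ω' hs ht h => by
      obtain ⟨t, htT, hω⟩ := mem_iUnion₂.1 h
      exact mem_iUnion₂.2 ⟨t, htT, TwoSetExchange.typeMinus_openConn_of_mem Sx Tx (Finset.mem_coe.2 htT) o hs ht hω⟩)
    (fun ω ω' hs ht h b hb => TwoSetExchange.typeMinus_not_openConn_of_mem Sx Tx hcS b hs ht (h b hb))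
  have hOT : (⋃ t ∈ T, (openConn t o : Set (BondConfig (Fin n)))) = ⋃ t ∈ T, (openConn o t : Set (BondConfig (Fin n))) := by
    refine iUnion₂_congr fun t _ => ?_
    exact KNPreFKG.openConn_symm t o
  rw [sep_singleton_eq c T, hOT] at key
  simpa only [inter_univ, univ_inter, inter_comm] using key

/-- **Partition by the relay block of `c`.**  For every event `E`,
`μ(E) = Σ_{B ⊆ A} μ(E ∩ {π(c) = B})` with `π(c) = {z ∈ A : c ↔ z}`. [folklore] -/
theorem real_eq_sum_blocks (w : Sym2 (Fin n) → unitInterval) (A : Finset (Fin n)) (c : Fin n)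
    (E : Set (BondConfig (Fin n))) :
    (prodBernoulli w).real E =
      ∑ B ∈ A.powerset, (prodBernoulli w).real (E ∩ {ω | (A.filter fun z => ω ∈ openConn c z) = B}) := by
  have hmeas : ∀ s : Set (BondConfig (Fin n)), MeasurableSet s := fun _ => MeasurableSet.of_discrete
  have hcover : E = ⋃ B ∈ A.powerset, (E ∩ {ω | (A.filter fun z => ω ∈ openConn c z) = B}) := by
    ext ω
    simp only [mem_iUnion, mem_inter_iff, mem_setOf_eq, exists_prop]
    constructor
    · intro h
      exact ⟨A.filter fun z => ω ∈ openConn c z, Finset.mem_powerset.2 (Finset.filter_subset _ _), h, rfl⟩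
    · rintro ⟨B, -, h, -⟩; exact h
  have hdisj : Set.PairwiseDisjoint (↑A.powerset : Set (Finset (Fin n)))
      (fun B => E ∩ {ω | (A.filter fun z => ω ∈ openConn c z) = B}) := by
    intro B _ B' _ hBB'
    refine Set.disjoint_left.2 fun ω hω hω' => hBB' ?_
    exact hω.2.symm.trans hω'.2
  conv_lhs => rw [hcover]
  exact measureReal_biUnion_finset hdisj (fun B _ => hmeas _)

/-- The relay block of `c` equals `B` (`c ∈ B ⊆ A`) iff `c` is joined to every `b ∈ B` and cut from `A ∖ B`. [folklore] -/
theorem blockEq_iff (A B : Finset (Fin n)) (c : Fin n) (hBA : B ⊆ A) (ω : BondConfig (Fin n)) :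
    (A.filter fun z => ω ∈ openConn c z) = B ↔
      (∀ t ∈ A \ B, ω ∉ openConn c t) ∧ (∀ b ∈ B, ω ∈ openConn c b) := by
  constructor
  · intro h
    refine ⟨fun t ht hct => ?_, fun b hb => ?_⟩
    · obtain ⟨htA, htB⟩ := Finset.mem_sdiff.1 ht
      exact htB (h ▸ Finset.mem_filter.2 ⟨htA, hct⟩)
    · have : b ∈ A.filter fun z => ω ∈ openConn c z := h ▸ hb
      exact (Finset.mem_filter.1 this).2
  · rintro ⟨hcut, hjoin⟩
    ext z
    simp only [Finset.mem_filter]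
    constructor
    · rintro ⟨hzA, hcz⟩
      by_contra hzB
      exact hcut z (Finset.mem_sdiff.2 ⟨hzA, hzB⟩) hcz
    · intro hzB; exact ⟨hBA hzB, hjoin z hzB⟩

end TwoLevelPackingCardSubTwo

end Summit.CriticalPhenomena.PercolationContinuityZ3.Theorems

end
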